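import Mathlib
import Summits.ValiantsHypothesis.ValiantsHypothesis.Theorems.LacunarySymmetroidMatrixDescartesUniversalWordEnds
import Summits.ValiantsHypothesis.ValiantsHypothesis.Theorems.LacunarySymmetroidMatrixDescartesInertiaCertificate
import Summits.ValiantsHypothesis.ValiantsHypothesis.Theorems.LacunarySymmetroidMatrixDescartesInertiaParity

/-!
# `MatrixDescartes` (stmt-ValiantsHypothesis-18050) — THE DEGENERATE DRIFT AND PARITY LAWS for the universal two-sided word
# (PSD letters on both sides of an ARBITRARY, possibly singular, pivot; no Gram matrix, no invertibility)

HONEST FRAMING.  Cell `pub-symmetroid`, seat `val-sym-mdr-p2` (gen 22); helper file `--supports` the crux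
`Theses.LacunarySymmetroid.MatrixDescartes` (OPEN), NO closure claim.  Consequences of `…UniversalWordEnds` for the crux's universal
word: LOWER bounds and a congruence for the positive root count from letter data.  These are STRUCTURE laws (drift, parity), not a
ceiling: nothing here bears on the crux in its window, `stub_twoSided`, `DoorA26` / `DoorA34`, registers, or `VP ≠ VNP`.  The tree's
drift / parity laws of gen 21 (`GramDual.drift_le_card_posRoots`, `pencil_drift_le_card_posRoots`) need `det S₀ ≠ 0` and non-singular
Gram blocks; here NOTHING is assumed invertible — the price is that the end inertias are only pinned up to the kernels of the two
compressions, so the drift bound uses `ν` at one end and `ν̄` at the other, and parity needs the two compressions (not the pivot)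
non-singular.

SETTING as in `…UniversalWordEnds`: real symmetric letters, pivot `S₀ = S l₀` arbitrary, all other letters PSD with `d l ≠ d l₀`;
`B_U`, `B_L` bases (killed by the upper / lower letters; FULL = spanning the joint kernel), `C_U = B_UᵀS₀B_U`, `C_L = B_LᵀS₀B_L`;
`det F ≢ 0`.

* **`univ_drift_lower_upper`** — `B_U` full: `Z₊(mult) + card α ≥ ν(C_L) + π(C_U)`, i.e. `Z₊(mult) ≥ ν(S₀|W_L) − ν̄(S₀|W_U)`.
* **`univ_drift_upper_lower`** — `B_L` full: `Z₊(mult) + card β ≥ ν(C_U) + π(C_L)`, i.e. `Z₊(mult) ≥ ν(S₀|W_U) − ν̄(S₀|W_L)`.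
* `univ_eventually_negIndex_eq_large` / `_small` — if the compression is NON-SINGULAR (`ν(C_U) + π(C_U) = card α`), the end inertia is
  EXACT: `ν(F(x)) = ν(C_U)` for large `x` (resp. `= ν(C_L)` for small `x`) — with a possibly singular pivot.
* **`univ_parity`** — both compressions non-singular, `B_U`, `B_L` full: `Z₊(mult) ≡ ν(C_U) + ν(C_L) (mod 2)` (tree
  `Inertia.even_negIndex_add_negIndex_add_card_roots`).
Mechanism: the end inequalities of `…UniversalWordEnds` at a non-singular scale below all positive roots and one above all roots, and the
tree's `Inertia.dist_negIndex_le_card_roots_gap` (`|ν(F(b)) − ν(F(a))| ≤ #roots in (a,b)` with multiplicity).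

[folklore] (Sylvester's law of inertia in family language; continuity of the spectrum).  Axioms `propext`, `Classical.choice`,
`Quot.sound`.  No definitions.
-/

-- layout Summits/ValiantsHypothesis/ValiantsHypothesis forces the duplicated namespace component
set_option linter.dupNamespace false

namespace Summit.ValiantsHypothesis.ValiantsHypothesis.Theorems.LacunarySymmetroidMatrixDescartes

open Polynomial Matrix Finset
open scoped BigOperators

namespace GramDual

section UniversalDrift

variable {ι κ : Type} [Fintype ι] [DecidableEq ι] [Fintype κ] [DecidableEq κ]

omit [DecidableEq κ] in
/-- Bracketing scales: given `ε > 0`, `X` and `det F ≢ 0`, there are non-singular `0 < a ≤ ε`, `a < b`, `X ≤ b` with every positive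
root of `det F` in `(a, b)`. [folklore] -/
theorem exists_bracket (d : κ → ℕ) (S : κ → Matrix ι ι ℝ)
    (hdet : Matrix.det (∑ l, ((Polynomial.X : Polynomial ℝ) ^ d l) • (S l).map Polynomial.C) ≠ 0)
    {ε X : ℝ} (hε : 0 < ε) :
    ∃ a b : ℝ, 0 < a ∧ a ≤ ε ∧ a < b ∧ X ≤ b ∧ (∑ l, a ^ d l • S l).det ≠ 0 ∧ (∑ l, b ^ d l • S l).det ≠ 0 ∧
      ∀ t ∈ (Matrix.det (∑ l, ((Polynomial.X : Polynomial ℝ) ^ d l) • (S l).map Polynomial.C)).roots, 0 < t → a < t ∧ t < b := by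
  classical
  set P := Matrix.det (∑ l, ((Polynomial.X : Polynomial ℝ) ^ d l) • (S l).map Polynomial.C) with hPdef
  set b : ℝ := max X (2 + (P.roots.toFinset.sum fun t => |t|)) with hbdef
  set a : ℝ := min ε (1 + ((P.roots.toFinset.filter (fun t => 0 < t)).sum fun t => t⁻¹))⁻¹ with hadef
  have hsumnn : 0 ≤ P.roots.toFinset.sum fun t => |t| := Finset.sum_nonneg fun t _ => abs_nonneg t
  have hsum'nn : 0 ≤ (P.roots.toFinset.filter (fun t => 0 < t)).sum fun t => t⁻¹ :=
    Finset.sum_nonneg fun t ht => (inv_pos.2 (Finset.mem_filter.1 ht).2).le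
  have hb2 : 2 ≤ b := le_trans (by linarith) (le_max_right _ _)
  have hapos : 0 < a := lt_min hε (by positivity)
  have ha1 : a ≤ 1 := le_trans (min_le_right _ _) (inv_le_one_of_one_le₀ (by linarith))
  have hroot_lt_b : ∀ t ∈ P.roots, t < b := by
    intro t ht
    have hmem : t ∈ P.roots.toFinset := Multiset.mem_toFinset.2 ht
    have h1 : |t| ≤ P.roots.toFinset.sum fun t => |t| :=
      Finset.single_le_sum (f := fun t => |t|) (fun t _ => abs_nonneg t) hmem
    have h2 : t ≤ |t| := le_abs_self t
    have h3 : 2 + (P.roots.toFinset.sum fun t => |t|) ≤ b := le_max_right _ _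
    linarith
  have hroot_gt_a : ∀ t ∈ P.roots, 0 < t → a < t := by
    intro t ht htpos
    have hmem : t ∈ P.roots.toFinset.filter (fun t => 0 < t) :=
      Finset.mem_filter.2 ⟨Multiset.mem_toFinset.2 ht, htpos⟩
    have h1 : t⁻¹ ≤ (P.roots.toFinset.filter (fun t => 0 < t)).sum fun t => t⁻¹ :=
      Finset.single_le_sum (f := fun t => t⁻¹) (fun s hs => (inv_pos.2 (Finset.mem_filter.1 hs).2).le) hmem
    have h2 : t⁻¹ < 1 + (P.roots.toFinset.filter (fun t => 0 < t)).sum fun t => t⁻¹ := by linarith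
    calc a ≤ (1 + (P.roots.toFinset.filter (fun t => 0 < t)).sum fun t => t⁻¹)⁻¹ := min_le_right _ _
      _ < t⁻¹⁻¹ := inv_strictAnti₀ (inv_pos.2 htpos) h2
      _ = t := inv_inv t
  have hmem_of_det : ∀ s : ℝ, (∑ l, s ^ d l • S l).det = 0 → s ∈ P.roots := by
    intro s h0
    rw [Polynomial.mem_roots hdet, Polynomial.IsRoot.def, hPdef, DefiniteMoments.eval_det_pencil]
    exact h0
  refine ⟨a, b, hapos, min_le_left _ _, by linarith, le_max_left _ _, fun h0 => ?_, fun h0 => ?_,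
    fun t ht htpos => ⟨hroot_gt_a t ht htpos, hroot_lt_b t ht⟩⟩
  · exact lt_irrefl a (hroot_gt_a a (hmem_of_det a h0) hapos)
  · exact lt_irrefl b (hroot_lt_b b (hmem_of_det b h0))

/-- Roots in a bracket `(a, b)` containing all positive roots are the positive roots. [folklore] -/
theorem filter_Ioo_eq_filter_pos {P : Polynomial ℝ} {a b : ℝ} (ha : 0 < a)
    (hwin : ∀ t ∈ P.roots, 0 < t → a < t ∧ t < b) :
    P.roots.filter (fun t => a < t ∧ t < b) = P.roots.filter (fun t => 0 < t) :=
  Multiset.filter_congr fun t ht => ⟨fun h => lt_trans ha h.1, fun h => hwin t ht h⟩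

/-- **DEGENERATE DRIFT LAW, I** (`B_U` full, any `B_L` killed by the lower letters): `Z₊(mult) + card α ≥ ν(C_L) + π(C_U)`. [folklore] -/
theorem univ_drift_lower_upper (d : κ → ℕ) (S : κ → Matrix ι ι ℝ) (hS : ∀ l, (S l).IsSymm) (l₀ : κ)
    (hpsd : ∀ l, l ≠ l₀ → (S l).PosSemidef) (hd : ∀ l, l ≠ l₀ → d l ≠ d l₀)
    (hdet : Matrix.det (∑ l, ((Polynomial.X : Polynomial ℝ) ^ d l) • (S l).map Polynomial.C) ≠ 0)
    {α β : Type} [Fintype α] [DecidableEq α] [Fintype β] [DecidableEq β]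
    (BU : Matrix ι α ℝ) (hBU : ∀ l, d l₀ < d l → S l * BU = 0)
    (hBUspan : ∀ v : ι → ℝ, (∀ l, d l₀ < d l → S l *ᵥ v = 0) → ∃ c : α → ℝ, BU *ᵥ c = v)
    (BL : Matrix ι β ℝ) (hBL : ∀ l, d l < d l₀ → S l * BL = 0)
    (hCU : (BUᵀ * S l₀ * BU).IsHermitian) (hCL : (BLᵀ * S l₀ * BL).IsHermitian) :
    Fintype.card {j // hCL.eigenvalues j < 0} + Fintype.card {j // 0 < hCU.eigenvalues j}
      ≤ Multiset.card ((Matrix.det (∑ l, ((Polynomial.X : Polynomial ℝ) ^ d l) • (S l).map Polynomial.C)).roots.filter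
        (fun t => 0 < t)) + Fintype.card α := by
  classical
  obtain ⟨X, hX, hlarge⟩ := univ_eventually_negIndex_le_large d S hS l₀ hpsd hd BU hBU hBUspan hCU
  obtain ⟨ε, hε, hsmall⟩ := univ_eventually_negIndex_ge_small d S hS l₀ hpsd hd BL hBL hCL
  obtain ⟨a, b, ha0, haε, hab, hXb, ha, hb, hwin⟩ := exists_bracket d S hdet (X := X) hε
  have hdist := Inertia.dist_negIndex_le_card_roots_gap d S hS hdet hab.le ha hb
  rw [filter_Ioo_eq_filter_pos ha0 hwin] at hdist
  have h1 := hlarge b hXb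
  have h2 := hsmall a ha0 haε
  have h3 := Nat.dist_tri_left (Fintype.card {j // (Inertia.isHermitian_pencil d S hS b).eigenvalues j < 0})
    (Fintype.card {j // (Inertia.isHermitian_pencil d S hS a).eigenvalues j < 0})
  have h4 := Nat.dist_tri_left' (Fintype.card {j // (Inertia.isHermitian_pencil d S hS b).eigenvalues j < 0})
    (Fintype.card {j // (Inertia.isHermitian_pencil d S hS a).eigenvalues j < 0})
  omega

/-- **DEGENERATE DRIFT LAW, II** (`B_L` full, any `B_U` killed by the upper letters): `Z₊(mult) + card β ≥ ν(C_U) + π(C_L)`. [folklore] -/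
theorem univ_drift_upper_lower (d : κ → ℕ) (S : κ → Matrix ι ι ℝ) (hS : ∀ l, (S l).IsSymm) (l₀ : κ)
    (hpsd : ∀ l, l ≠ l₀ → (S l).PosSemidef) (hd : ∀ l, l ≠ l₀ → d l ≠ d l₀)
    (hdet : Matrix.det (∑ l, ((Polynomial.X : Polynomial ℝ) ^ d l) • (S l).map Polynomial.C) ≠ 0)
    {α β : Type} [Fintype α] [DecidableEq α] [Fintype β] [DecidableEq β]
    (BU : Matrix ι α ℝ) (hBU : ∀ l, d l₀ < d l → S l * BU = 0)
    (BL : Matrix ι β ℝ) (hBL : ∀ l, d l < d l₀ → S l * BL = 0)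
    (hBLspan : ∀ v : ι → ℝ, (∀ l, d l < d l₀ → S l *ᵥ v = 0) → ∃ c : β → ℝ, BL *ᵥ c = v)
    (hCU : (BUᵀ * S l₀ * BU).IsHermitian) (hCL : (BLᵀ * S l₀ * BL).IsHermitian) :
    Fintype.card {j // hCU.eigenvalues j < 0} + Fintype.card {j // 0 < hCL.eigenvalues j}
      ≤ Multiset.card ((Matrix.det (∑ l, ((Polynomial.X : Polynomial ℝ) ^ d l) • (S l).map Polynomial.C)).roots.filter
        (fun t => 0 < t)) + Fintype.card β := by
  classical
  obtain ⟨X, hX, hlarge⟩ := univ_eventually_negIndex_ge_large d S hS l₀ hpsd hd BU hBU hCU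
  obtain ⟨ε, hε, hsmall⟩ := univ_eventually_negIndex_le_small d S hS l₀ hpsd hd BL hBL hBLspan hCL
  obtain ⟨a, b, ha0, haε, hab, hXb, ha, hb, hwin⟩ := exists_bracket d S hdet (X := X) hε
  have hdist := Inertia.dist_negIndex_le_card_roots_gap d S hS hdet hab.le ha hb
  rw [filter_Ioo_eq_filter_pos ha0 hwin] at hdist
  have h1 := hlarge b hXb
  have h2 := hsmall a ha0 haε
  have h3 := Nat.dist_tri_left (Fintype.card {j // (Inertia.isHermitian_pencil d S hS b).eigenvalues j < 0})
    (Fintype.card {j // (Inertia.isHermitian_pencil d S hS a).eigenvalues j < 0})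
  have h4 := Nat.dist_tri_left' (Fintype.card {j // (Inertia.isHermitian_pencil d S hS b).eigenvalues j < 0})
    (Fintype.card {j // (Inertia.isHermitian_pencil d S hS a).eigenvalues j < 0})
  omega

/-- **Exact upper end inertia with a non-singular compression**: `B_U` full, `ν(C_U) + π(C_U) = card α` ⇒ `ν(F(x)) = ν(C_U)` for all
large `x`. [folklore] -/
theorem univ_eventually_negIndex_eq_large (d : κ → ℕ) (S : κ → Matrix ι ι ℝ) (hS : ∀ l, (S l).IsSymm) (l₀ : κ)
    (hpsd : ∀ l, l ≠ l₀ → (S l).PosSemidef) (hd : ∀ l, l ≠ l₀ → d l ≠ d l₀)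
    {α : Type} [Fintype α] [DecidableEq α] (BU : Matrix ι α ℝ) (hBU : ∀ l, d l₀ < d l → S l * BU = 0)
    (hBUspan : ∀ v : ι → ℝ, (∀ l, d l₀ < d l → S l *ᵥ v = 0) → ∃ c : α → ℝ, BU *ᵥ c = v)
    (hCU : (BUᵀ * S l₀ * BU).IsHermitian)
    (hnons : Fintype.card {j // hCU.eigenvalues j < 0} + Fintype.card {j // 0 < hCU.eigenvalues j} = Fintype.card α) :
    ∃ X : ℝ, 0 < X ∧ ∀ x : ℝ, X ≤ x →
      Fintype.card {j // (Inertia.isHermitian_pencil d S hS x).eigenvalues j < 0} = Fintype.card {j // hCU.eigenvalues j < 0} := by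
  obtain ⟨X, hX, hle⟩ := univ_eventually_negIndex_le_large d S hS l₀ hpsd hd BU hBU hBUspan hCU
  obtain ⟨X', hX', hge⟩ := univ_eventually_negIndex_ge_large d S hS l₀ hpsd hd BU hBU hCU
  refine ⟨max X X', lt_max_of_lt_left hX, fun x hx => ?_⟩
  have h1 := hle x (le_trans (le_max_left _ _) hx)
  have h2 := hge x (le_trans (le_max_right _ _) hx)
  omega

/-- **Exact lower end inertia with a non-singular compression**: `B_L` full, `ν(C_L) + π(C_L) = card β` ⇒ `ν(F(x)) = ν(C_L)` for all
small `x > 0`. [folklore] -/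
theorem univ_eventually_negIndex_eq_small (d : κ → ℕ) (S : κ → Matrix ι ι ℝ) (hS : ∀ l, (S l).IsSymm) (l₀ : κ)
    (hpsd : ∀ l, l ≠ l₀ → (S l).PosSemidef) (hd : ∀ l, l ≠ l₀ → d l ≠ d l₀)
    {β : Type} [Fintype β] [DecidableEq β] (BL : Matrix ι β ℝ) (hBL : ∀ l, d l < d l₀ → S l * BL = 0)
    (hBLspan : ∀ v : ι → ℝ, (∀ l, d l < d l₀ → S l *ᵥ v = 0) → ∃ c : β → ℝ, BL *ᵥ c = v)
    (hCL : (BLᵀ * S l₀ * BL).IsHermitian)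
    (hnons : Fintype.card {j // hCL.eigenvalues j < 0} + Fintype.card {j // 0 < hCL.eigenvalues j} = Fintype.card β) :
    ∃ ε : ℝ, 0 < ε ∧ ∀ x : ℝ, 0 < x → x ≤ ε →
      Fintype.card {j // (Inertia.isHermitian_pencil d S hS x).eigenvalues j < 0} = Fintype.card {j // hCL.eigenvalues j < 0} := by
  obtain ⟨ε, hε, hle⟩ := univ_eventually_negIndex_le_small d S hS l₀ hpsd hd BL hBL hBLspan hCL
  obtain ⟨ε', hε', hge⟩ := univ_eventually_negIndex_ge_small d S hS l₀ hpsd hd BL hBL hCL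
  refine ⟨min ε ε', lt_min hε hε', fun x hx0 hx => ?_⟩
  have h1 := hle x hx0 (le_trans hx (min_le_left _ _))
  have h2 := hge x hx0 (le_trans hx (min_le_right _ _))
  omega

/-- **DEGENERATE PARITY LAW**: both compressions non-singular, both bases full, `det F ≢ 0` ⇒ `Z₊(mult) + ν(C_U) + ν(C_L)` is even.
[folklore] -/
theorem univ_parity (d : κ → ℕ) (S : κ → Matrix ι ι ℝ) (hS : ∀ l, (S l).IsSymm) (l₀ : κ)
    (hpsd : ∀ l, l ≠ l₀ → (S l).PosSemidef) (hd : ∀ l, l ≠ l₀ → d l ≠ d l₀)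
    (hdet : Matrix.det (∑ l, ((Polynomial.X : Polynomial ℝ) ^ d l) • (S l).map Polynomial.C) ≠ 0)
    {α β : Type} [Fintype α] [DecidableEq α] [Fintype β] [DecidableEq β]
    (BU : Matrix ι α ℝ) (hBU : ∀ l, d l₀ < d l → S l * BU = 0)
    (hBUspan : ∀ v : ι → ℝ, (∀ l, d l₀ < d l → S l *ᵥ v = 0) → ∃ c : α → ℝ, BU *ᵥ c = v)
    (BL : Matrix ι β ℝ) (hBL : ∀ l, d l < d l₀ → S l * BL = 0)
    (hBLspan : ∀ v : ι → ℝ, (∀ l, d l < d l₀ → S l *ᵥ v = 0) → ∃ c : β → ℝ, BL *ᵥ c = v)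
    (hCU : (BUᵀ * S l₀ * BU).IsHermitian) (hCL : (BLᵀ * S l₀ * BL).IsHermitian)
    (hnonsU : Fintype.card {j // hCU.eigenvalues j < 0} + Fintype.card {j // 0 < hCU.eigenvalues j} = Fintype.card α)
    (hnonsL : Fintype.card {j // hCL.eigenvalues j < 0} + Fintype.card {j // 0 < hCL.eigenvalues j} = Fintype.card β) :
    Even (Multiset.card ((Matrix.det (∑ l, ((Polynomial.X : Polynomial ℝ) ^ d l) • (S l).map Polynomial.C)).roots.filter
        (fun t => 0 < t)) + Fintype.card {j // hCU.eigenvalues j < 0} + Fintype.card {j // hCL.eigenvalues j < 0}) := by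
  classical
  obtain ⟨X, hX, hlarge⟩ := univ_eventually_negIndex_eq_large d S hS l₀ hpsd hd BU hBU hBUspan hCU hnonsU
  obtain ⟨ε, hε, hsmall⟩ := univ_eventually_negIndex_eq_small d S hS l₀ hpsd hd BL hBL hBLspan hCL hnonsL
  obtain ⟨a, b, ha0, haε, hab, hXb, ha, hb, hwin⟩ := exists_bracket d S hdet (X := X) hε
  have hpar := Inertia.even_negIndex_add_negIndex_add_card_roots d S hS hab.le ha hb
  rw [filter_Ioo_eq_filter_pos ha0 hwin, hsmall a ha0 haε, hlarge b hXb] at hpar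
  obtain ⟨k, hk⟩ := hpar
  exact ⟨k, by omega⟩

end UniversalDrift

end GramDual

end Summit.ValiantsHypothesis.ValiantsHypothesis.Theorems.LacunarySymmetroidMatrixDescartes
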